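import Summits.KontsevichZagierPeriods.KontsevichZagierPeriods.Theorems.SoloInformedParamMap
import Summits.KontsevichZagierPeriods.KontsevichZagierPeriods.Theorems.SoloInformedParamNL
import HarnessLib

/-!
# First-order clauses for the change-of-variables move

For a map term `M` (the diffeomorphism `Φ`, `SoloInformedParamMap`) and terms `T`, `T'` (the two
representations) over a common parameter space we write the side conditions of move (2) of
`soloInformedBddChangeOfVariablesRel` as conditions on the parameter `p` that are visibly
`ℚ`-semialgebraic (block form, polynomial atoms):

* `SoloInformedInjClause M p` — `Φ` is injective on the domain;
* `SoloInformedImgClause M T' p` — the domain of `T'` is the image of `Φ`;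
* `SoloInformedDiffClause M T T' p` — for every `x` in the domain there is a matrix `L` with
  `g x = g' (Φ x) · |det L|` (`g`, `g'` the graph values of `T`, `T'`) which is a derivative of `Φ`
  within the domain at `x` (an `ε`–`δ` condition in sup-norm coordinates).

The point of the last clause is that the derivative is quantified pointwise (`∀ x ∃ L`), so no
semialgebraic selection of the Jacobian is needed: move (2) only asks for *some* family `Φ'`.
The translation of the clauses into analysis is in `SoloInformedParamCoVMeaning`.

References: [cite: BochnakCosteRoy1998, Prop. 2.2.4, Prop. 2.9.1];
[cite: KontsevichZagier2001, §1.2].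
-/

noncomputable section

open Set MvPolynomial Literature.ModelTheory.ExponentialFields
  Literature.NumberTheory.Transcendental

namespace Summit.KontsevichZagierPeriods.KontsevichZagierPeriods.Theorems

/-! ### Polynomial atoms -/

/-- The linearised derivative inequality
`(u a - u b - ∑ₖ u (ℓ k)·(u (c k) - u (d k)))² ≤ (u e)²·(u f - u g)²` is `ℚ`-semialgebraic.
[cite: BochnakCosteRoy1998, Def. 2.1.4] -/
theorem soloInformed_isSemialgebraic_setOf_linDerivIneq {ι : Type*} {m : ℕ} (a b e f g : ι)
    (ℓ c d : Fin m → ι) :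
    IsSemialgebraic ℚ {u : ι → ℝ |
      (u a - u b - ∑ k, u (ℓ k) * (u (c k) - u (d k))) ^ 2 ≤ u e ^ 2 * (u f - u g) ^ 2} := by
  have hset : {u : ι → ℝ |
      (u a - u b - ∑ k, u (ℓ k) * (u (c k) - u (d k))) ^ 2 ≤ u e ^ 2 * (u f - u g) ^ 2} =
      {u | aeval u ((X a - X b - ∑ k, X (ℓ k) * (X (c k) - X (d k))) ^ 2 : MvPolynomial ι ℚ) ≤
        aeval u (X e ^ 2 * (X f - X g) ^ 2 : MvPolynomial ι ℚ)} := by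
    ext u
    simp only [mem_setOf_eq, map_pow, map_sub, map_mul, map_sum, aeval_X]
  rw [hset]
  exact isSemialgebraic_setOf_eval_le _ _

/-- `y₀ = y₁·|D|` as a polynomial condition. [folklore] -/
theorem soloInformed_eq_mul_abs_iff (y₀ y₁ D : ℝ) :
    y₀ = y₁ * |D| ↔ y₀ ^ 2 = y₁ ^ 2 * D ^ 2 ∧ 0 ≤ y₀ * y₁ := by
  constructor
  · rintro rfl
    refine ⟨by rw [mul_pow, sq_abs], ?_⟩
    have : y₁ * |D| * y₁ = y₁ ^ 2 * |D| := by ring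
    rw [this]
    positivity
  · rintro ⟨h1, h2⟩
    have h1' : y₀ ^ 2 = (y₁ * |D|) ^ 2 := by rw [mul_pow, sq_abs, h1]
    rcases sq_eq_sq_iff_eq_or_eq_neg.1 h1' with h | h
    · exact h
    · have h3 : y₁ ^ 2 * |D| = 0 := by
        have h4 : y₀ * y₁ = -(y₁ ^ 2 * |D|) := by rw [h]; ring
        have h5 : 0 ≤ y₁ ^ 2 * |D| := by positivity
        linarith
      rcases mul_eq_zero.1 h3 with h6 | h6
      · rw [h, (pow_eq_zero_iff two_ne_zero).1 h6]
        simp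
      · rw [h, h6]
        simp

/-- The Jacobian identity `u a = u b · |det (u (ℓ i j))ᵢⱼ|` is `ℚ`-semialgebraic.
[cite: BochnakCosteRoy1998, Def. 2.1.4] -/
theorem soloInformed_isSemialgebraic_setOf_eq_mul_absDet {ι : Type*} {m : ℕ} (a b : ι)
    (ℓ : Fin m → Fin m → ι) :
    IsSemialgebraic ℚ {u : ι → ℝ | u a = u b * |(Matrix.of fun i j => u (ℓ i j)).det|} := by
  let MX : Matrix (Fin m) (Fin m) (MvPolynomial ι ℚ) := Matrix.of fun i j => X (ℓ i j)
  have hdet : ∀ u : ι → ℝ, aeval u MX.det = (Matrix.of fun i j => u (ℓ i j)).det := by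
    intro u
    rw [AlgHom.map_det]
    congr 1
    ext i j
    simp only [MX, AlgHom.mapMatrix_apply, Matrix.map_apply, Matrix.of_apply, aeval_X]
  have hset : {u : ι → ℝ | u a = u b * |(Matrix.of fun i j => u (ℓ i j)).det|} =
      {u | aeval u (X a ^ 2 - X b ^ 2 * MX.det ^ 2 : MvPolynomial ι ℚ) = 0} ∩
        {u | 0 ≤ aeval u (X a * X b : MvPolynomial ι ℚ)} := by
    ext u
    simp only [mem_setOf_eq, mem_inter_iff, map_sub, map_mul, map_pow, aeval_X, hdet,
      sub_eq_zero]
    exact soloInformed_eq_mul_abs_iff _ _ _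
  rw [hset]
  exact (isSemialgebraic_setOf_eval_eq_zero _).inter (isSemialgebraic_setOf_eval_nonneg _)

/-! ### Reading fibres off block tuples -/

namespace SoloInformedPTerm

variable {K : Type} {d : ℕ} (T : SoloInformedPTerm K d) {τ : Type*} (u : τ → ℝ) (π : K → τ)

/-- A domain point read off a tuple. [cite: BochnakCosteRoy1998, Prop. 2.2.4] -/
theorem comp_elim_mem_S_iff (ξ : Fin d → τ) :
    u ∘ Sum.elim π ξ ∈ T.S ↔ u ∘ ξ ∈ T.fibre (u ∘ π) := by
  rw [Sum.comp_elim]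
  rfl

/-- A graph point read off a tuple. [cite: BochnakCosteRoy1998, Prop. 2.2.4] -/
theorem comp_elim_snoc_mem_G_iff (ξ : Fin d → τ) (a : τ) :
    u ∘ Sum.elim π (Fin.snoc ξ a) ∈ T.G ↔ Fin.snoc (u ∘ ξ) (u a) ∈ T.gfibre (u ∘ π) := by
  rw [Sum.comp_elim, Fin.comp_snoc]
  rfl

end SoloInformedPTerm

namespace SoloInformedPMap

variable {K : Type} {d e : ℕ} (M : SoloInformedPMap K d e) {τ : Type*} (u : τ → ℝ) (π : K → τ)

/-- A domain point read off a tuple. [cite: BochnakCosteRoy1998, Prop. 2.2.4] -/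
theorem comp_elim_mem_S_iff (ξ : Fin d → τ) :
    u ∘ Sum.elim π ξ ∈ M.S ↔ u ∘ ξ ∈ M.fibre (u ∘ π) := by
  rw [Sum.comp_elim]
  rfl

/-- A graph point read off a tuple. [cite: BochnakCosteRoy1998, Prop. 2.2.4] -/
theorem comp_elim_append_mem_G_iff (ξ : Fin d → τ) (η : Fin e → τ) :
    u ∘ Sum.elim π (Fin.append ξ η) ∈ M.G ↔
      Fin.append (u ∘ ξ) (u ∘ η) ∈ M.gfibre (u ∘ π) := by
  have h : u ∘ Fin.append ξ η = Fin.append (u ∘ ξ) (u ∘ η) := by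
    funext i
    refine Fin.addCases (fun j => ?_) (fun j => ?_) i
    · simp only [Function.comp_apply, Fin.append_left]
    · simp only [Function.comp_apply, Fin.append_right]
  rw [Sum.comp_elim, h]
  rfl

/-! ### The clauses -/

variable {n : ℕ}

/-- Injectivity of the map on its domain, in block form. [cite: BochnakCosteRoy1998, Prop. 2.2.4] -/
def SoloInformedInjClause (M : SoloInformedPMap K n n) (p : K → ℝ) : Prop :=
  ∀ (x : Fin n → ℝ) (w : Fin n ⊕ Fin n → ℝ), x ∈ M.fibre p → w ∘ Sum.inl ∈ M.fibre p →
    Fin.append x (w ∘ Sum.inr) ∈ M.gfibre p →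
      Fin.append (w ∘ Sum.inl) (w ∘ Sum.inr) ∈ M.gfibre p → ∀ i, x i = w (Sum.inl i)

/-- The domain of `T'` is the image of the map, in block form.
[cite: BochnakCosteRoy1998, Prop. 2.2.4] -/
def SoloInformedImgClause (M : SoloInformedPMap K n n) (T' : SoloInformedPTerm K n) (p : K → ℝ) :
    Prop :=
  ∀ y : Fin n → ℝ, y ∈ T'.fibre p ↔ ∃ x : Fin n → ℝ, x ∈ M.fibre p ∧ Fin.append x y ∈ M.gfibre p

/-- Pointwise existence of a Jacobian matrix `L`: the Jacobian identity between the graph values of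
`T` and `T'`, and differentiability of the map within its domain with derivative `L`
(`ε`–`δ`, sup norm), in block form. [cite: BochnakCosteRoy1998, Prop. 2.9.1] -/
def SoloInformedDiffClause (M : SoloInformedPMap K n n) (T T' : SoloInformedPTerm K n)
    (p : K → ℝ) : Prop :=
  ∀ x ∈ M.fibre p, ∃ L : Fin n × Fin n → ℝ,
    (∀ w : Fin n ⊕ Fin 2 → ℝ, Fin.append x (w ∘ Sum.inl) ∈ M.gfibre p →
      Fin.snoc x (w (Sum.inr 0)) ∈ T.gfibre p →
        Fin.snoc (w ∘ Sum.inl) (w (Sum.inr 1)) ∈ T'.gfibre p →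
          w (Sum.inr 0) = w (Sum.inr 1) * |(Matrix.of fun i j => L (i, j)).det|) ∧
    ∀ ε : Fin 1 → ℝ, 0 < ε 0 → ∃ δ : Fin 1 → ℝ, 0 < δ 0 ∧
      ∀ w : Fin n ⊕ (Fin n ⊕ Fin n) → ℝ, w ∘ Sum.inl ∈ M.fibre p →
        Fin.append (w ∘ Sum.inl) (w ∘ Sum.inr ∘ Sum.inl) ∈ M.gfibre p →
          Fin.append x (w ∘ Sum.inr ∘ Sum.inr) ∈ M.gfibre p →
            (∀ i, (w (Sum.inl i) - x i) ^ 2 < δ 0 ^ 2) →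
              ∀ i, ∃ j, (w (Sum.inr (Sum.inl i)) - w (Sum.inr (Sum.inr i)) -
                ∑ k, L (i, k) * (w (Sum.inl k) - x k)) ^ 2 ≤
                  ε 0 ^ 2 * (w (Sum.inl j) - x j) ^ 2

/-! ### The clauses are `ℚ`-semialgebraic -/

/-- The injectivity clause is `ℚ`-semialgebraic in the parameter.
[cite: BochnakCosteRoy1998, Prop. 2.2.4] -/
theorem isSemialgebraic_setOf_injClause [Finite K] (M : SoloInformedPMap K n n) :
    IsSemialgebraic ℚ {p : K → ℝ | M.SoloInformedInjClause p} := by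
  let B : Set ((K ⊕ Fin n) ⊕ (Fin n ⊕ Fin n) → ℝ) := {u |
    u ∘ Sum.inl ∈ M.S →
    u ∘ Sum.elim (fun k => Sum.inl (Sum.inl k)) (fun i => Sum.inr (Sum.inl i)) ∈ M.S →
    u ∘ Sum.elim (fun k => Sum.inl (Sum.inl k))
      (Fin.append (fun i => Sum.inl (Sum.inr i)) (fun j => Sum.inr (Sum.inr j))) ∈ M.G →
    u ∘ Sum.elim (fun k => Sum.inl (Sum.inl k))
      (Fin.append (fun i => Sum.inr (Sum.inl i)) (fun j => Sum.inr (Sum.inr j))) ∈ M.G →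
    ∀ i : Fin n, u (Sum.inl (Sum.inr i)) = u (Sum.inr (Sum.inl i))}
  have hB : IsSemialgebraic ℚ B :=
    soloInformed_isSemialgebraic_setOf_imp (M.hS.preimage_comp _)
      (soloInformed_isSemialgebraic_setOf_imp (M.hS.preimage_comp _)
        (soloInformed_isSemialgebraic_setOf_imp (M.hG.preimage_comp _)
          (soloInformed_isSemialgebraic_setOf_imp (M.hG.preimage_comp _)
            (soloInformed_isSemialgebraic_setOf_forall_fin fun i =>
              soloInformed_isSemialgebraic_setOf_coord_eq _ _))))
  unfold SoloInformedInjClause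
  refine soloInformed_isSemialgebraic_setOf_forall_fibre
    (soloInformed_isSemialgebraic_setOf_forall_block hB fun _ => Iff.rfl) fun p x => ?_
  simp only [B, mem_setOf_eq, Sum.elim_comp_inl, comp_elim_mem_S_iff, comp_elim_append_mem_G_iff]
  simp only [Function.comp_def, Sum.elim_inl, Sum.elim_inr, mem_fibre, mem_gfibre]

/-- The image clause is `ℚ`-semialgebraic in the parameter.
[cite: BochnakCosteRoy1998, Prop. 2.2.4] -/
theorem isSemialgebraic_setOf_imgClause [Finite K] (M : SoloInformedPMap K n n)
    (T' : SoloInformedPTerm K n) :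
    IsSemialgebraic ℚ {p : K → ℝ | M.SoloInformedImgClause T' p} := by
  let E : Set ((K ⊕ Fin n) ⊕ Fin n → ℝ) := {v |
    v ∘ Sum.elim (fun k => Sum.inl (Sum.inl k)) (fun i => Sum.inr i) ∈ M.S ∧
    v ∘ Sum.elim (fun k => Sum.inl (Sum.inl k))
      (Fin.append (fun i => Sum.inr i) (fun j => Sum.inl (Sum.inr j))) ∈ M.G}
  have hE : IsSemialgebraic ℚ E :=
    soloInformed_isSemialgebraic_setOf_and (M.hS.preimage_comp _) (M.hG.preimage_comp _)
  have hB : IsSemialgebraic ℚ {u : K ⊕ Fin n → ℝ | u ∈ T'.S ↔ ∃ z, Sum.elim u z ∈ E} :=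
    soloInformed_isSemialgebraic_setOf_iff T'.hS
      (soloInformed_isSemialgebraic_setOf_exists_block hE fun _ => Iff.rfl)
  unfold SoloInformedImgClause
  refine soloInformed_isSemialgebraic_setOf_forall_fibre hB fun p y => ?_
  simp only [E, mem_setOf_eq, comp_elim_mem_S_iff, comp_elim_append_mem_G_iff]
  simp only [Function.comp_def, Sum.elim_inl, Sum.elim_inr, mem_fibre, mem_gfibre,
    SoloInformedPTerm.mem_fibre]

/-- The differentiability/Jacobian clause is `ℚ`-semialgebraic in the parameter.
[cite: BochnakCosteRoy1998, Prop. 2.2.4, Prop. 2.9.1] -/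
theorem isSemialgebraic_setOf_diffClause [Finite K] (M : SoloInformedPMap K n n)
    (T T' : SoloInformedPTerm K n) :
    IsSemialgebraic ℚ {p : K → ℝ | M.SoloInformedDiffClause T T' p} := by
  -- level 1: `((p, x), L)`; Jacobian block `w : Fin n ⊕ Fin 2`
  let J : Set ((((K ⊕ Fin n) ⊕ (Fin n × Fin n)) ⊕ (Fin n ⊕ Fin 2)) → ℝ) := {v |
    v ∘ Sum.elim (fun k => Sum.inl (Sum.inl (Sum.inl k)))
      (Fin.append (fun i => Sum.inl (Sum.inl (Sum.inr i))) (fun j => Sum.inr (Sum.inl j))) ∈ M.G →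
    v ∘ Sum.elim (fun k => Sum.inl (Sum.inl (Sum.inl k)))
      (Fin.snoc (fun i => Sum.inl (Sum.inl (Sum.inr i))) (Sum.inr (Sum.inr 0))) ∈ T.G →
    v ∘ Sum.elim (fun k => Sum.inl (Sum.inl (Sum.inl k)))
      (Fin.snoc (fun i => Sum.inr (Sum.inl i)) (Sum.inr (Sum.inr 1))) ∈ T'.G →
    v (Sum.inr (Sum.inr 0)) = v (Sum.inr (Sum.inr 1)) *
      |(Matrix.of fun i j => v (Sum.inl (Sum.inr (i, j)))).det|}
  have hJ : IsSemialgebraic ℚ J :=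
    soloInformed_isSemialgebraic_setOf_imp (M.hG.preimage_comp _)
      (soloInformed_isSemialgebraic_setOf_imp (T.hG.preimage_comp _)
        (soloInformed_isSemialgebraic_setOf_imp (T'.hG.preimage_comp _)
          (soloInformed_isSemialgebraic_setOf_eq_mul_absDet _ _ _)))
  -- derivative block `w : Fin n ⊕ (Fin n ⊕ Fin n)` over `((((p, x), L), ε), δ)`
  let I : Set ((((((K ⊕ Fin n) ⊕ (Fin n × Fin n)) ⊕ Fin 1) ⊕ Fin 1) ⊕
      (Fin n ⊕ (Fin n ⊕ Fin n))) → ℝ) := {v |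
    v ∘ Sum.elim (fun k => Sum.inl (Sum.inl (Sum.inl (Sum.inl (Sum.inl k)))))
      (fun i => Sum.inr (Sum.inl i)) ∈ M.S →
    v ∘ Sum.elim (fun k => Sum.inl (Sum.inl (Sum.inl (Sum.inl (Sum.inl k)))))
      (Fin.append (fun i => Sum.inr (Sum.inl i)) (fun j => Sum.inr (Sum.inr (Sum.inl j)))) ∈ M.G →
    v ∘ Sum.elim (fun k => Sum.inl (Sum.inl (Sum.inl (Sum.inl (Sum.inl k)))))
      (Fin.append (fun i => Sum.inl (Sum.inl (Sum.inl (Sum.inl (Sum.inr i)))))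
        (fun j => Sum.inr (Sum.inr (Sum.inr j)))) ∈ M.G →
    (∀ i : Fin n,
      (v (Sum.inr (Sum.inl i)) - v (Sum.inl (Sum.inl (Sum.inl (Sum.inl (Sum.inr i)))))) ^ 2 <
        v (Sum.inl (Sum.inr 0)) ^ 2) →
    ∀ i : Fin n, ∃ j : Fin n,
      (v (Sum.inr (Sum.inr (Sum.inl i))) - v (Sum.inr (Sum.inr (Sum.inr i))) -
      ∑ k, v (Sum.inl (Sum.inl (Sum.inl (Sum.inr (i, k))))) *
        (v (Sum.inr (Sum.inl k)) - v (Sum.inl (Sum.inl (Sum.inl (Sum.inl (Sum.inr k))))))) ^ 2 ≤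
      v (Sum.inl (Sum.inl (Sum.inr 0))) ^ 2 *
        (v (Sum.inr (Sum.inl j)) - v (Sum.inl (Sum.inl (Sum.inl (Sum.inl (Sum.inr j)))))) ^ 2}
  have hI : IsSemialgebraic ℚ I :=
    soloInformed_isSemialgebraic_setOf_imp (M.hS.preimage_comp _)
      (soloInformed_isSemialgebraic_setOf_imp (M.hG.preimage_comp _)
        (soloInformed_isSemialgebraic_setOf_imp (M.hG.preimage_comp _)
          (soloInformed_isSemialgebraic_setOf_imp
            (soloInformed_isSemialgebraic_setOf_forall_fin fun i =>
              soloInformed_isSemialgebraic_setOf_sq_sub_lt _ _ _)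
            (soloInformed_isSemialgebraic_setOf_forall_fin fun i =>
              soloInformed_isSemialgebraic_setOf_exists_fin fun j =>
                soloInformed_isSemialgebraic_setOf_linDerivIneq _ _ _ _ _ _ _ _))))
  let D : Set (((((K ⊕ Fin n) ⊕ (Fin n × Fin n)) ⊕ Fin 1) ⊕ Fin 1) → ℝ) :=
    {u | 0 < u (Sum.inr 0) ∧ ∀ z, Sum.elim u z ∈ I}
  have hD : IsSemialgebraic ℚ D :=
    soloInformed_isSemialgebraic_setOf_and (soloInformed_isSemialgebraic_setOf_coord_pos _)
      (soloInformed_isSemialgebraic_setOf_forall_block hI fun _ => Iff.rfl)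
  let E : Set ((((K ⊕ Fin n) ⊕ (Fin n × Fin n)) ⊕ Fin 1) → ℝ) :=
    {u | 0 < u (Sum.inr 0) → ∃ z, Sum.elim u z ∈ D}
  have hE : IsSemialgebraic ℚ E :=
    soloInformed_isSemialgebraic_setOf_imp (soloInformed_isSemialgebraic_setOf_coord_pos _)
      (soloInformed_isSemialgebraic_setOf_exists_block hD fun _ => Iff.rfl)
  let C : Set (K ⊕ Fin n → ℝ) := {u | u ∈ M.S → ∃ z : Fin n × Fin n → ℝ,
    Sum.elim u z ∈ {u₁ | ∀ z, Sum.elim u₁ z ∈ J} ∩ {u₁ | ∀ z, Sum.elim u₁ z ∈ E}}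
  have hC : IsSemialgebraic ℚ C :=
    soloInformed_isSemialgebraic_setOf_imp M.hS
      (soloInformed_isSemialgebraic_setOf_exists_block
        ((soloInformed_isSemialgebraic_setOf_forall_block hJ fun _ => Iff.rfl).inter
          (soloInformed_isSemialgebraic_setOf_forall_block hE fun _ => Iff.rfl)) fun _ => Iff.rfl)
  unfold SoloInformedDiffClause
  refine soloInformed_isSemialgebraic_setOf_forall_fibre hC fun p x => ?_
  simp only [C, J, E, D, I, mem_setOf_eq, mem_inter_iff, SoloInformedPTerm.comp_elim_snoc_mem_G_iff,
    comp_elim_mem_S_iff, comp_elim_append_mem_G_iff]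
  simp only [Function.comp_def, Sum.elim_inl, Sum.elim_inr, mem_fibre, mem_gfibre,
    SoloInformedPTerm.mem_gfibre]

end SoloInformedPMap

end Summit.KontsevichZagierPeriods.KontsevichZagierPeriods.Theorems
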